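import Summits.BirchSwinnertonDyer.BirchSwinnertonDyer.Theorems.RamifiedHeegnerPairLeafPartnerPairingCore
import Summits.BirchSwinnertonDyer.BirchSwinnertonDyer.Theorems.RamifiedHeegnerPairLeafPartnerRTFlat
import HarnessLib

/-!
# Route `RamifiedHeegnerPair`, crux U₁ `LeafRankOneUpperAtThree` (stmt-BirchSwinnertonDyer-26022), line `partnerdescent` —
# partner kernel part 12: the PARTNER PAIRING CORE on a PAIR from the FLAT cokernel property (G3♭)

HONEST FRAMING. Theorems only; helper file (`--supports stmt-BirchSwinnertonDyer-26022 --as helper`); no definition, no named fact, no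
`sorry`; nothing booked, no item closed; CONDITIONAL on every displayed input; BSD is proved for no curve. Lead prover bsd-line-rhp-p2 g57,
2026-08-30. WHAT: `leafRankOneUpper_three_of_partnerDatum_at_pair_flat` — part 3 of the partner kernel (p776667) with (G3) ↦ (G3♭) and
`S = {q, r}` with `#V(ℚ_q)[3] ≠ 9` (see `RamifiedHeegnerPairLeafPartnerRTFlat.lean` for the why). The road on the ORPHAN PAIRS with a
non-scalar prime (every orphan pair of the W-census, LEAD-G57-G3-LEDGER.md) thereby runs on a statement implied by route item 27595 AND
derivable from print.
-/

-- D-0017: single-problem summit, so `Summit.BirchSwinnertonDyer.BirchSwinnertonDyer.…` repeats a namespace BY DESIGN.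
set_option linter.dupNamespace false
set_option autoImplicit false

noncomputable section


open scoped Classical NumberField

open WeierstrassCurve NumberField IsDedekindDomain Literature Literature.NumberTheory.EllipticCurves
  Rat.HeightOneSpectrum CongruenceSubgroup
  Literature.NumberTheory.EllipticCurves.ModularForms
  Literature.NumberTheory.EllipticCurves.Rank1Residual
  Literature.NumberTheory.EllipticCurves.Rank1Residual.Typed
  Literature.NumberTheory.QuadraticFields.Quadratic
  Literature.NumberTheory.GaloisCohomology
  Literature.NumberTheory.Automorphic
  Summit.BirchSwinnertonDyer.Rank1Residual
  Summit.BirchSwinnertonDyer.Rank1Residual.Additive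
  Summit.BirchSwinnertonDyer.Rank1Residual.X11b
  Summit.BirchSwinnertonDyer.Rank1Residual.X11b.Three
  Summit.BirchSwinnertonDyer.BirchSwinnertonDyer.Theses.RamifiedHeegnerPair
  Summit.BirchSwinnertonDyer.BirchSwinnertonDyer.Theorems

namespace Summit.BirchSwinnertonDyer.BirchSwinnertonDyer.Theorems.LeafShimuraInert

/-- **U₁ AT A LEAF CURVE FROM ONE FIELD DATUM ON A PAIR, THE PARTNER'S FLAT RIBET–TAKAHASHI PACKAGE AND A PARTNER-SOURCED REAL
DISPLAY.** VERBATIM the tree's `LeafShimuraInert.leafRankOneUpper_three_of_partnerDatum_at_pairing` (partner kernel part 3, p776667)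
with the inert set a PAIR `S = {q, r}` and the hypothesis (G3) REPLACED by the FLAT (G3♭) (cokernel `3`-freeness at `r` when the partner
`V` does NOT have full `3`-torsion over `ℚ_q` — the lead's pen-agreed non-scalar derivation's shape), plus that non-scalar hypothesis
`#V(ℚ_q)[3] ≠ 9`; the (DEG) step is the pair telescope `LeafPartnerRTFlat.padicValNat_delta_empty_pair_of_cokernelUnit` (ONE cokernel
unit suffices). Everything else byte-for-byte. CONCLUSION: `Typed.MissingUpperBoundAt W 3`. CONDITIONAL; nothing booked; BSD is not proved.
-- adapted from Summits/BirchSwinnertonDyer/BirchSwinnertonDyer/Theorems/RamifiedHeegnerPairLeafPartnerPairingCore.lean ((G3) ↦ (G3♭), S a pair)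
[cite: CaiShuTian2014, Thm. 1.1 and Thm. 1.5] [cite: PastenShimura2024, Prop. 6.13, Lemmas 6.8, 6.14, §6.9]
[cite: PapikianRabinoff2016, Thm. 30, Lemma 32] [cite: JetchevSkinnerWan2017, §7.4.2 and Thm. 4.4.1]
[cite: McCallumLMS1991, §1 Theorem (Kolyvagin)] [cite: Miller2011LMS, Def. 1.1] -/
theorem leafRankOneUpper_three_of_partnerDatum_at_pair_flat
    -- published inputs (named facts of the tree)
    (hGZK : rank_eq_analyticRank_of_analyticRank_le_one) (hmod : hasEntireLFunction_rat)
    (hnf : exists_isNewformOf) (hJL : nonempty_shimuraParametrizationData)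
    -- (G3♭): the Pasten package WITH the FLAT cokernel `3`-freeness property (body of `Partnerdescent.PartnerCokernelThreeFreeFlat`)
    (hG3 : ∃ cI cJ : ComponentOrderFun,
      (∀ {D M : ℕ} {X : ShimuraCurveData D M} {W' : WeierstrassCurve ℚ}
          (P : ShimuraParametrizationData X W') (p : ℕ), 0 < cI P p ∧ 0 < cJ P p) ∧
      ComponentOrders.ProductEq cI cJ ∧ ComponentOrders.Prop613 cI cJ ∧
      ComponentOrders.ImageEisenstein cI ∧ ComponentOrders.CokernelDvd cJ ∧
      (∀ {N D M : ℕ}, IsAdmissibleFactorization N D M →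
        ∀ (X : ShimuraCurveData D M) (V : WeierstrassCurve ℚ) [V.IsElliptic] [V.IsGloballyMinimal],
          V.conductorNorm ℤ = N → ¬ 3 ∣ N → Irr V 3 →
        ∀ (q r : ℕ) [Fact q.Prime] [Fact r.Prime], q ≠ r → D = q * r →
          Nat.card (AddSubgroup.torsionBy ((V.baseChange ℚ_[q]).toAffine.Point) 3) ≠ 9 →
        ∀ (V' : WeierstrassCurve ℚ) [V'.IsElliptic] (P : ShimuraParametrizationData X V'),
          P.IsMinimalFor V → ¬ 3 ∣ cJ P r))
    -- the leaf curve, with any classical datum (for the Néron lattice)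
    (W : WeierstrassCurve ℚ) [W.IsElliptic] [W.IsGloballyMinimal]
    (hadd : Addv W 3) (hsub : SubGss W 3) (hr : W.analyticRank = 1)
    {N : ℕ} [NeZero N] (hN : W.conductorNorm ℤ = N)
    (Dt : ModularParametrizationData W N)
    -- the partner: globally minimal, `3 ∤ N_V`, `V[3]` irreducible, with its optimal datum `D₀` (`3 ∤ c`)
    (V : WeierstrassCurve ℚ) [V.IsElliptic] [V.IsGloballyMinimal]
    {NV : ℕ} [NeZero NV] (hNV : V.conductorNorm ℤ = NV) (h3NV : ¬ 3 ∣ NV)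
    (hirrV : V.HasIrreducibleModPGaloisRep 3)
    (V₀ : WeierstrassCurve ℚ) [V₀.IsElliptic] [V₀.IsGloballyMinimal] (D₀ : ModularParametrizationData V₀ NV)
    (hfV : IsNewformOf V D₀.f)
    (hminV : ∀ (V₂ : WeierstrassCurve ℚ) [V₂.IsElliptic] (D₂ : ModularParametrizationData V₂ NV),
      D₂.f = D₀.f → D₀.modularDegree ≤ D₂.modularDegree)
    (hcV : ¬ (3 : ℤ) ∣ D₀.c)
    -- the inert PAIR `S = {q, r}`, `V` NOT fully `3`-torsion over `ℚ_q`; multiplicative for BOTH curves, same discriminant valuations,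
    -- every carrier of `W` inside
    (q r : ℕ) [Fact q.Prime] [Fact r.Prime] (hqr : q ≠ r)
    (hns : Nat.card (AddSubgroup.torsionBy ((V.baseChange ℚ_[q]).toAffine.Point) 3) ≠ 9)
    (S : Finset ℕ) (hS2 : S = insert q {r}) (hSeven : Even S.card)
    (hSmult : ∀ ℓ ∈ S, ∃ _ : Fact ℓ.Prime, W.HasMultiplicativeReductionAtPrime ℓ)
    (hSmultV : ∀ ℓ ∈ S, ∃ _ : Fact ℓ.Prime, V.HasMultiplicativeReductionAtPrime ℓ)
    (hΔS : ∀ ℓ ∈ S, padicValInt ℓ V.minimalDiscriminantInt = padicValInt ℓ W.minimalDiscriminantInt)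
    (hFC : ∀ (ℓ : ℕ) [Fact ℓ.Prime], ℓ ∉ S → W.HasSplitMultiplicativeReductionAtPrime ℓ →
      ¬ 3 ∣ padicValInt ℓ W.minimalDiscriminantInt)
    -- SHAPE: every Tamagawa-`3` carrier of `W` is split multiplicative
    (hshape : ∀ (q : ℕ) [Fact q.Prime], 3 ∣ (W.baseChange ℚ_[q]).localTamagawaNumber ℤ_[q] →
      W.HasSplitMultiplicativeReductionAtPrime q)
    -- ONE field datum, `d_K` odd
    (K : Type) [Field K] [NumberField K] (hK : IsImaginaryQuadratic K) (hodd : Odd (NumberField.discr K))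
    (hinert : ∀ ℓ ∈ S, ((Ideal.span {(ℓ : ℤ)}).primesOver (𝓞 K)).ncard = 1 ∧ ¬ (ℓ : ℤ) ∣ NumberField.discr K)
    (hsplitN : ∀ ℓ : ℕ, ℓ.Prime → ℓ ∣ W.conductorNorm ℤ → ℓ ∉ S →
      ((Ideal.span {(ℓ : ℤ)}).primesOver (𝓞 K)).ncard = 2)
    (hLt : (W.quadraticTwist (NumberField.discr K : ℚ)).entireLFunction 1 ≠ 0)
    -- the PARTNER-sourced point, real display and order bound AT `V`'s class-minimal Shimura datum
    (hHKat : ∀ (X : ShimuraCurveData (∏ q ∈ S, q) (NV / ∏ q ∈ S, q)) (V' : WeierstrassCurve ℚ) [V'.IsElliptic]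
      (P₀ : ShimuraParametrizationData X V'), P₀.IsMinimalFor V →
      ∃ (P : (W.baseChange K).toAffine.Point) (degS : ℕ), 0 < degS ∧
        padicValNat 3 degS = padicValNat 3 P₀.deg ∧
        (degS : ℂ) * LDerivEK W K =
          ((2 * ZLattice.covolume Dt.L.lattice * (D₀.modularDegree : ℝ) /
              ((D₀.c : ℝ) ^ 2 * ((Units.torsionOrder K : ℝ) / 2) ^ 2 * √|(NumberField.discr K : ℝ)|) *
            P.canonicalHeight : ℝ) : ℂ) ∧
        (¬ IsOfFinAddOrder P →
          Nat.card (AddCommGroup.primaryComponent (W.baseChange K).sha 3) ≤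
            3 ^ (2 * padicValNat 3 (AddSubgroup.zmultiples P).index)))
    -- the partner's LOWER half at this field
    (hPL : ∀ (Wd : WeierstrassCurve ℚ) [Wd.IsElliptic] [Wd.IsGloballyMinimal] (Cd : VariableChange ℚ),
      Cd • W.quadraticTwist (NumberField.discr K : ℚ) = Wd → Typed.MissingLowerBoundAt Wd 3) :
    Typed.MissingUpperBoundAt W 3 := by
  subst hN
  subst hNV
  haveI h3F : Fact (Nat.Prime 3) := ⟨Nat.prime_three⟩
  have hp : (3 : ℕ).Prime := Nat.prime_three
  have hp2 : (3 : ℕ) ≠ 2 := by decide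
  have hirr : W.HasIrreducibleModPGaloisRep 3 := Additive.irr_of_subGss_of_ne_two W 3 hp2 hadd hsub
  have hbad3 : ¬ W.HasGoodReductionAtPrime 3 := not_good_of_addv W 3 hadd
  have hnm3 : ¬ W.HasMultiplicativeReductionAtPrime 3 := not_mult_of_addv W 3 hadd
  have hNV0 : V.conductorNorm ℤ ≠ 0 := (V.conductorNorm_pos_holds).ne'
  -- the set of multiplicative primes OF THE PARTNER and its Pasten package with (PG3)
  set Mlt : Finset ℕ := (V.conductorNorm ℤ).primeFactors.filter
    (fun q ↦ ∃ h : q.Prime, @WeierstrassCurve.HasMultiplicativeReductionAtPrime V q ⟨h⟩) with hMlt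
  have hmemMlt : ∀ {q : ℕ} [hq : Fact q.Prime], V.HasMultiplicativeReductionAtPrime q → q ∈ Mlt := by
    intro q hq hm
    have hqN : q ∣ V.conductorNorm ℤ :=
      (V.dvd_conductorNorm_iff_not_hasGoodReductionAtPrime q).mpr
        (WeierstrassCurve.HasMultiplicativeReduction.not_hasGoodReduction (R := ℤ_[q]) hm)
    exact Finset.mem_filter.mpr ⟨Nat.mem_primeFactors.mpr ⟨hq.out, hqN, hNV0⟩, hq.out, hm⟩
  obtain ⟨δ, cA, ι, κ, hδ0, hδ, hcA, hanchor, h613, hij, h68, hEis, -, hG3κ⟩ :=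
    LeafPartnerRTFlat.ribetTakahashiPackageCokerThreeFlat_of_componentOrdersFiveFlat hG3 PastenShimura2024_lemma_6_8_isogeny_holds
      hJL V 3 hirrV (V.conductorNorm ℤ) V₀ D₀ rfl hfV hminV
  obtain ⟨hvA, hι⟩ := rtPackage_valuation_forms V 3 hirrV hcA h68 hEis
  -- the inert set sits inside the partner's multiplicative primes and avoids `3`
  have hSMlt : S ⊆ Mlt := by
    intro ℓ hℓ
    obtain ⟨hℓF, hm⟩ := hSmultV ℓ hℓ
    exact @hmemMlt ℓ hℓF hm
  have hpS : 3 ∉ S := by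
    intro h
    obtain ⟨_, hm⟩ := hSmult 3 h
    exact hnm3 hm
  -- (DEG) FOR THE PARTNER from (G3♭): the ONE cokernel of the pair level at `r` is `3`-free (`V` not fully `3`-torsion over `ℚ_q`)
  have hqr' : q ∉ ({r} : Finset ℕ) := by simp [hqr]
  have hqM : q ∈ Mlt := hSMlt (by rw [hS2]; exact Finset.mem_insert_self q {r})
  have hrM : r ∈ Mlt := hSMlt (by rw [hS2]; exact Finset.mem_insert_of_mem (Finset.mem_singleton_self r))
  have hκ : padicValNat 3 (κ (insert q {r}) r) = 0 :=
    padicValNat.eq_zero_of_not_dvd (hG3κ h3NV hirrV hqM hrM hqr hns)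
  have hdegV : padicValNat 3 (δ ∅) =
      padicValNat 3 (δ S) + ∑ x ∈ S, padicValNat 3 (padicValInt x V.minimalDiscriminantInt) := by
    rw [hS2, LeafPartnerRTFlat.padicValNat_delta_empty_pair_of_cokernelUnit h613 hδ hcA hij hvA hι hqM hrM hqr hκ,
      Finset.sum_insert hqr', Finset.sum_singleton, add_assoc]
  have hdeg : padicValNat 3 (δ ∅) =
      padicValNat 3 (δ S) + ∑ x ∈ S, padicValNat 3 (padicValInt x W.minimalDiscriminantInt) := by
    rw [hdegV, Finset.sum_congr rfl fun x hx ↦ by rw [hΔS x hx]]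
  -- field data
  have h2 := hK.1
  have hd4 : NumberField.discr K % 4 = 1 := discr_emod_four_eq_one hK.1 hodd
  have h3N : 3 ∣ W.conductorNorm ℤ := (W.dvd_conductorNorm_iff_not_hasGoodReductionAtPrime 3).mpr hbad3
  have hps2 : ((Ideal.span {((3 : ℕ) : ℤ)}).primesOver (𝓞 K)).ncard = 2 := hsplitN 3 hp h3N hpS
  have hps : SplitsIn K 3 := hps2
  have hpd : ¬ ((3 : ℕ) : ℤ) ∣ NumberField.discr K := not_dvd_discr_of_splitsIn h2 hp hps
  -- `d_K < -4` (odd, `≠ -3`), so `w_K = 2` is prime to `3`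
  have hμ : ¬ 3 ∣ Units.torsionOrder K := by
    haveI : IsTotallyComplex K := hK.2
    have hneg : NumberField.discr K < 0 := discr_neg_of_finrank_eq_two K hK.1
    have h3d : NumberField.discr K ≠ -3 := by
      intro h; apply hpd; rw [h]; norm_num
    have h4 : NumberField.discr K < -4 := by omega
    rw [Literature.NumberTheory.DiophantineGeometry.torsionOrder_eq_two_of_discr_lt hK.1 h4]
    decide
  have hSin : ∀ ℓ ∈ S, ∃ _ : Fact ℓ.Prime, Mult W ℓ ∧
      ((ℓ ≠ 2 ∧ jacobiSym (NumberField.discr K) ℓ = -1) ∨ (ℓ = 2 ∧ NumberField.discr K % 8 = 5)) := by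
    intro ℓ hℓ
    obtain ⟨hℓF, hm⟩ := hSmult ℓ hℓ
    obtain ⟨hn, hd⟩ := hinert ℓ hℓ
    refine ⟨hℓF, hm, ?_⟩
    have hn' : ((Ideal.span {(ℓ : ℤ)}).primesOver (𝓞 K)).ncard ≠ 2 := by rw [hn]; decide
    by_cases hℓ2 : ℓ = 2
    · subst hℓ2
      have hn2 : ((Ideal.span {(2 : ℤ)}).primesOver (𝓞 K)).ncard ≠ 2 := by
        simpa only [Nat.cast_ofNat] using hn'
      have hd2 : ¬ (2 : ℤ) ∣ NumberField.discr K := by simpa only [Nat.cast_ofNat] using hd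
      exact Or.inr ⟨rfl, discr_emod_eight_eq_five_of_ncard_ne_two h2 hn2 hd2⟩
    · exact Or.inl ⟨hℓ2, jacobiSym_discr_eq_neg_one_of_ncard_ne_two h2 hℓF.out hℓ2 hn' hd⟩
  have hsplit : ∀ (ℓ : ℕ) [Fact ℓ.Prime], ¬ W.HasGoodReductionAtPrime ℓ → ℓ ∉ S →
      IsSquare (algebraMap ℚ ℚ_[ℓ] (NumberField.discr K : ℚ)) := by
    intro ℓ hℓF hg hℓS
    have hℓN : ℓ ∣ W.conductorNorm ℤ := (W.dvd_conductorNorm_iff_not_hasGoodReductionAtPrime ℓ).mpr hg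
    exact isSquare_discr_padic_of_ncard_eq_two h2 ℓ (hsplitN ℓ hℓF.out hℓN hℓS)
  -- `d_K` odd: the ramified primes of `K` are good primes `≥ 5` (`2 ∤ d_K`, `3 ∤ d_K`)
  have hdodd : ¬ (2 : ℤ) ∣ NumberField.discr K := by
    obtain ⟨k, hk⟩ := hodd
    omega
  have h5 : ∀ (q : ℕ) [Fact q.Prime], (q : ℤ) ∣ NumberField.discr K → W.HasGoodReductionAtPrime q →
      5 ≤ q ∨ 5 ≤ 3 := by
    intro q hqF hqd _
    have hq : q.Prime := hqF.out
    have hq2 : q ≠ 2 := by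
      rintro rfl
      exact hdodd (by exact_mod_cast hqd)
    have hq3 : q ≠ 3 := by
      rintro rfl
      exact hpd hqd
    exact Or.inl (hq.five_le_of_ne_two_of_ne_three hq2 hq3)
  -- a globally minimal model of the twist, differing from the twisted equation by a `3`-unit; it is a rank-zero LEAF curve
  have hD0 : (NumberField.discr K : ℚ) ≠ 0 := by exact_mod_cast NumberField.discr_ne_zero K
  haveI hEt : (W.quadraticTwist (NumberField.discr K : ℚ)).IsElliptic :=
    W.isElliptic_quadraticTwist hD0
  obtain ⟨Cd, hCd⟩ := hasGlobalMinimalModel_rat_holds (W.quadraticTwist (NumberField.discr K : ℚ))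
  haveI : (Cd • W.quadraticTwist (NumberField.discr K : ℚ)).IsGloballyMinimal := hCd
  set Wd : WeierstrassCurve ℚ := Cd • W.quadraticTwist (NumberField.discr K : ℚ) with hWd_def
  have hWd : Cd • W.quadraticTwist (NumberField.discr K : ℚ) = Wd := rfl
  have hu : padicValRat 3 (Cd.u : ℚ) = 0 :=
    padicValRat_u_eq_zero_of_twist_minimal_of_splitsIn W 3 K h2 hps Cd hWd
  -- torsion: `3 ∤ #E(ℚ)_tors`, `3 ∤ #E^{d}(ℚ)_tors`
  have htW : ¬ 3 ∣ W.torsionOrder := not_dvd_torsionOrder_of_irr W 3 hirr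
  have hirrd : Wd.HasIrreducibleModPGaloisRep 3 :=
    hasIrreducibleModPGaloisRep_twist_model W 3 K h2 hirr Cd hWd
  have htd : ¬ 3 ∣ Wd.torsionOrder := not_dvd_torsionOrder_of_irr Wd 3 hirrd
  -- the rank-0 twist's algebraic central value (modular symbols) and its analytic rank
  have hmodP : nonempty_modularParametrizationData :=
    nonempty_modularParametrizationData_iff_exists_isNewformOf_unconditional.mpr hnf
  obtain ⟨qd, hqd⟩ :=
    Summit.BirchSwinnertonDyer.Rank1Residual.X1.RankZeroPartner.exists_rat_entireLFunction_one_div_realPeriodRat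
      hmodP Wd
  have hLt' : (W.quadraticTwist (NumberField.discr K : ℚ)).entireLFunction = Wd.entireLFunction := by
    rw [← hWd, entireLFunction_smul]
  have hLd1 : Wd.entireLFunction 1 ≠ 0 := by rw [← hLt']; exact hLt
  have hrd : Wd.analyticRank = 0 := (Wd.analyticRank_eq_zero_iff_holds (hmod Wd)).2 hLd1
  have hfinSd : Wd.ShaFinite := (hGZK Wd (by rw [hrd]; omega)).2
  have hfinW : W.ShaFinite := (hGZK W (by omega)).2
  ---------------------------------------------------------------- the PARTNER's Shimura curve of level `(∏S, N_V/∏S)` and its class-minimal datum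
  obtain ⟨X, V', hV', P₀, hP₀, hdegδ⟩ := hanchor hSMlt hSeven
  haveI := hV'
  ---------------------------------------------------------------- the partner-sourced point of `E(K)` with its real display and order bound
  obtain ⟨P, degS, hdegS, hlinkS, hGZR, hUShP⟩ := hHKat X V' P₀ hP₀
  have hlink₂ : padicValNat 3 degS = padicValNat 3 (δ S) := by rw [hlinkS, hdegδ]
  ---------------------------------------------------------------- non-torsion and (U-Sh)
  have hnt : ¬ IsOfFinAddOrder P :=
    LeafPartnerGZShape.not_isOfFinAddOrder_of_realDisplay hmod W K hr hLt P hdegS _ hGZR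
  have hUSh : Nat.card (AddCommGroup.primaryComponent (W.baseChange K).sha 3) ≤
      3 ^ (2 * padicValNat 3 (AddSubgroup.zmultiples P).index) := hUShP hnt
  -- (GZ-Sh₀) from the real display with the partner's constants, then the links
  obtain ⟨qE, hqE, hqd0, hE, h0⟩ := LeafPartnerGZShape.gzShape₀_of_realDisplay W 3 (W.conductorNorm ℤ) K Dt P degS
    D₀.modularDegree D₀.c hGZK hmod hK hp2 hcV hμ hr hLt hdegS hGZR Wd Cd hWd hu qd hqd htW htd
  have h₀ : (2 * padicValNat 3 (AddSubgroup.zmultiples P).index : ℤ) + padicValNat 3 (δ ∅) =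
      padicValRat 3 qE + padicValRat 3 qd + padicValNat 3 (δ S) := by
    rw [hδ0, ← hlink₂]; exact h0
  -- (GZ-Sh) = (GZ-Sh₀) + (DEG)
  have hGZSh : ∃ qE qd : ℚ, qE ≠ 0 ∧ qd ≠ 0 ∧
      W.leadingLCoeff / ((W.realPeriodRat : ℂ) * (W.regulator : ℂ)) = (qE : ℂ) ∧
      Wd.entireLFunction 1 / (Wd.realPeriodRat : ℂ) = (qd : ℂ) ∧
      (2 * padicValNat 3 (AddSubgroup.zmultiples P).index : ℤ) +
          (∑ ℓ ∈ S, padicValNat 3 (padicValInt ℓ W.minimalDiscriminantInt) : ℕ) =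
        padicValRat 3 qE + padicValRat 3 qd :=
    ⟨qE, qd, hqE, hqd0, hE, hqd, gzShape_of_gzShape₀_of_deg h₀ hdeg⟩
  ---------------------------------------------------------------- the numeric Tamagawa condition and the partner's lower half
  have hT := padicValNat_tamagawaProduct_add_twist_le_of_inertSet'_odd W 3 hp2 K h2 hdodd h5 hshape Cd hWd S
    hSin (fun ℓ _ hg hℓS ↦ hsplit ℓ hg hℓS) (fun ℓ _ hℓS hs ↦ hFC ℓ hℓS hs)
  have htw := twistLowerShape_of_missingLowerBoundAt_rankZero hGZK Wd hrd hqd0 hqd (hPL Wd Cd hWd)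
  exact missingUpperBoundAt_of_shimuraShapes W 3 hp2 K h2 Wd ⟨Cd, hWd⟩ hfinW hfinSd P _ hT htw hGZSh hUSh


end Summit.BirchSwinnertonDyer.BirchSwinnertonDyer.Theorems.LeafShimuraInert

end
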